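import Summits.PneNP.PneNP.Theorems.ChebyshevTracialDesignBulkNumerics
import HarnessLib

/-!
# Cell pnp-psdrank, route `ChebyshevTracialDesign`: the [BULK] numerics RE-RUN for the γ-direction — Lq's margins at the SMALLEST pinned
# edge number `N₀ − 2` with window slack `ε + 8`, a far-term budget `LB/(2N₀⁴)`, and the scale hypotheses of brick 140a
# (crux `TracialDecayExp20`, stmt-PneNP-19878)

Brick 140c (eng g26; MEMO-30 §4 «126b-type numerics»; companion of bricks 137/137b/139/140a/140b). Brick 124a part 2 (`bulk_numerics`) proves the
fourteen real inequalities of the crossing-plane [BULK] assembly for `P = N₀^{1/8} ≥ P*`, with the free length `L = 2D + √(4N₀R)`,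
`R = E + log(2C₃) + 2 log N₀ + D`, so that the far term `D(4/3)^D e^{−(L−2D)²/(4N₀)}` is `≤ LB/2`, `LB = e^{−E}/(C₃N₀²)`. The γ-direction
(bricks 135–140b) differs in three places, all harmless at the scale `P`: (1) its three law families live on `N₀, N₀−1, N₀−2` edges with the block
statistic shifted by `0, 2, 4`, so Lq's five real margins are wanted ONCE at `(N₀−2, ε+8)` (then `lqMargins_mono` serves the other two);
(2) `ε_B`'s and `ε_A`'s far terms carry polynomial weights (`m, a ≤ N₀`, `a² ≤ N₀²`, `1/(LB·V)`), so the far-term budget must beat `LB` by a power of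
`N₀` — here `R = E + log(2C₃) + 6·log N₀ + D`, giving `≤ LB/(2N₀⁴)`; (3) brick 140a's scale hypotheses `L + D + 1 ≤ c_L P⁵`, `32c_L/((β²/8)⁴β) ≤ P³`,
`P⁸/4 ≤ (N₀−2) − 2D` are exported (with `c_L` in the `∃`).
* **`gamma_bulk_numerics`**: for `0 < β ≤ 1/5`, `K, C₁, C₂ ≥ 0`, `C₃ > 0` there are `P* ≥ 0` and `c_L ≥ 0` such that for every real `N₀` with
  `N₀^{1/8} ≥ P*`, natural `D ≥ 1` with `D⁴ ≤ 2N₀`, `0 ≤ ε ≤ K√(2N₀D)`, and `E, R, L` as above, the nineteen listed inequalities hold.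
Pure real arithmetic (the proof is brick 124a's, re-run with the shifted targets). WHAT THIS FILE DOES NOT DO: anything combinatorial; `ε_A`;
anything on `TracialDecayExp20` itself, psd rank of P_PM(K_n), or P vs NP.
[cite: RollinRoss2010, §4.1 Thm 4.2 (the variance scale)] [cite: Agarwal2000DifferenceEquations, Remark 1.8.1]
Stature: support/instrument (kernel lane, no defs, axioms standard). Supports stmt-PneNP-19878.
-/

set_option linter.dupNamespace false -- `Summit.PneNP.PneNP.…`: summit = sub-problem (D-0017)

noncomputable section

namespace Summit.PneNP.PneNP.Theorems.ChebyshevTracialDesignGammaDirectionBulkNumerics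

open Real
open Summit.PneNP.PneNP.Theorems.ChebyshevTracialDesignBulkScale (scale_facts mul_fourThirds_pow_le_exp)

/-- **THE γ-DIRECTION [BULK] NUMERICS.** For `0 < β ≤ 1/5`, `K, C₁, C₂ ≥ 0`, `C₃ > 0` there are `P* ≥ 0`, `c_L ≥ 0` such that for every real
`N₀` with `N₀^{1/8} ≥ P*`, every natural `D ≥ 1` with `D⁴ ≤ 2N₀`, every `ε ∈ [0, K√(2N₀D)]`, and `E = C₁(ε+1+C₂)²/(β⁴(N₀−1))`,
`R = E + log(2C₃) + 6 log N₀ + D`, `L = 2D + √(4N₀R)`, writing `P = N₀^{1/8}` and `N₂ = (N₀ − 2) − 2D`: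
`16D+16 ≤ N₀−2`, `2D ≤ L`, `2L ≤ N₀−2`, Lq's five real margins at `(N₀−2, ε+8)`, the far-term budget
`D(4/3)^D e^{−(L−2D)²/(4N₀)} ≤ (e^{−E}/(C₃N₀²))/(2N₀⁴)`, brick 140a's scale hypotheses `L+D+1 ≤ c_L P⁵`, `32c_L/((β²/8)⁴β) ≤ P³`, `P⁸/4 ≤ N₂`,
and the balance bookkeeping `βN₀ + D + 3 ≤ N₀/4 − 1/2`, `8(N₀/2−1) ≤ (4+β)(N₀−2D)`, `2D + ε + 8 ≤ βN₀/4`, `0 ≤ R`, `ε + 9 ≤ β²(N₀−1)/2`,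
`24 ≤ (β²/8)⁴βN₀`. [cite: RollinRoss2010, §4.1 Thm 4.2] [cite: Agarwal2000DifferenceEquations, Remark 1.8.1] -/
theorem gamma_bulk_numerics {β K C₁ C₂ C₃ : ℝ} (hβ : 0 < β) (hβ5 : β ≤ 1 / 5) (hK : 0 ≤ K) (hC₁ : 0 ≤ C₁)
    (hC₂ : 0 ≤ C₂) (hC₃ : 0 < C₃) :
    ∃ Pstar cL : ℝ, 0 ≤ Pstar ∧ 0 ≤ cL ∧ ∀ N₀ : ℝ, Pstar ≤ N₀ ^ ((8 : ℕ) : ℝ)⁻¹ → 1 ≤ N₀ →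
      ∀ D : ℕ, 1 ≤ D → ((D : ℝ)) ^ 4 ≤ 2 * N₀ →
      ∀ ε : ℝ, 0 ≤ ε → ε ≤ K * Real.sqrt (2 * N₀ * D) →
      ∀ E R L : ℝ, E = C₁ * (ε + 1 + C₂) ^ 2 / (β ^ 4 * (N₀ - 1)) →
        R = E + Real.log (2 * C₃) + 6 * Real.log N₀ + D → L = 2 * D + Real.sqrt (4 * N₀ * R) →
      (16 * (D : ℝ) + 16 ≤ N₀ - 2) ∧ (2 * (D : ℝ) ≤ L) ∧ (2 * L ≤ N₀ - 2) ∧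
      (L + D + (ε + 8 + 14 * D + 1) ≤ β ^ 2 * (N₀ - 2)) ∧
      (L + D + (ε + 8 + 14 * D + 1) + 3 ≤ β * ((N₀ - 2) - 2 * D) / 8) ∧
      (2 * (L + D + 1) ≤ (β ^ 2 / 8) ^ 2 * (β * ((N₀ - 2) - 2 * D))) ∧
      (4 ≤ β * ((N₀ - 2) - 2 * D)) ∧
      ((D : ℝ) * (1 + 8 * (L + D + 1) / ((β ^ 2 / 8) ^ 4 * (β * ((N₀ - 2) - 2 * D)))) ≤
        (β ^ 2 / 8) ^ 4 * (β * ((N₀ - 2) - 2 * D))) ∧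
      ((D : ℝ) * (4 / 3 : ℝ) ^ D * Real.exp (-((L - 2 * D) ^ 2 / (4 * N₀))) ≤
        (Real.exp (-E) / (C₃ * N₀ ^ 2)) / (2 * N₀ ^ 4)) ∧
      (L + D + 1 ≤ cL * (N₀ ^ ((8 : ℕ) : ℝ)⁻¹) ^ 5) ∧ (32 * cL / ((β ^ 2 / 8) ^ 4 * β) ≤ (N₀ ^ ((8 : ℕ) : ℝ)⁻¹) ^ 3) ∧
      ((N₀ ^ ((8 : ℕ) : ℝ)⁻¹) ^ 8 / 4 ≤ (N₀ - 2) - 2 * D) ∧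
      (β * N₀ + D + 3 ≤ N₀ / 4 - 1 / 2) ∧ (8 * (N₀ / 2 - 1) ≤ (4 + β) * (N₀ - 2 * D)) ∧
      (2 * (D : ℝ) + ε + 8 ≤ β * N₀ / 4) ∧ (0 ≤ R) ∧
      (ε + 1 + 8 ≤ β ^ 2 * (N₀ - 1) / 2) ∧ (24 ≤ (β ^ 2 / 8) ^ 4 * (β * N₀)) := by
  obtain ⟨cΛ, hcΛ⟩ : ∃ c : ℝ, c = 2 * K + 37 := ⟨_, rfl⟩
  obtain ⟨cE, hcE⟩ : ∃ c : ℝ, c = 2 * C₁ * (2 * K + 1 + C₂) ^ 2 / β ^ 4 := ⟨_, rfl⟩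
  obtain ⟨cR, hcR⟩ : ∃ c : ℝ, c = cE + 50 + |Real.log (2 * C₃)| := ⟨_, rfl⟩
  obtain ⟨cL, hcL⟩ : ∃ c : ℝ, c = 4 + 2 * Real.sqrt cR := ⟨_, rfl⟩
  obtain ⟨cη, hcη⟩ : ∃ c : ℝ, c = 32 * (cL + 3) / ((β ^ 2 / 8) ^ 4 * β) := ⟨_, rfl⟩
  have hb10 : 0 < β ^ 2 / 8 := by positivity
  have hcE0 : 0 ≤ cE := by rw [hcE]; positivity
  have hcR0 : 0 ≤ cR := by rw [hcR]; positivity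
  have hcL4 : 4 ≤ cL := by rw [hcL]; linarith only [Real.sqrt_nonneg cR]
  have hcL0 : 0 ≤ cL := by linarith only [hcL4]
  have hcη0 : 0 ≤ cη := by rw [hcη]; positivity
  have hcΛ0 : 0 ≤ cΛ := by rw [hcΛ]; positivity
  obtain ⟨t1, ht1⟩ : ∃ c : ℝ, c = 32 / β := ⟨_, rfl⟩
  obtain ⟨t2, ht2⟩ : ∃ c : ℝ, c = 2 * (cL + 2 + cΛ) / β ^ 2 := ⟨_, rfl⟩
  obtain ⟨t3, ht3⟩ : ∃ c : ℝ, c = 32 * (cL + cΛ + 5) / β := ⟨_, rfl⟩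
  obtain ⟨t4, ht4⟩ : ∃ c : ℝ, c = 8 * (cL + 3) / ((β ^ 2 / 8) ^ 2 * β) := ⟨_, rfl⟩
  obtain ⟨t6, ht6⟩ : ∃ c : ℝ, c = 24 / ((β ^ 2 / 8) ^ 4 * β) := ⟨_, rfl⟩
  obtain ⟨t8, ht8⟩ : ∃ c : ℝ, c = 4 * (12 + 2 * K) / β := ⟨_, rfl⟩
  obtain ⟨t10, ht10⟩ : ∃ c : ℝ, c = 1 / (2 * C₃) := ⟨_, rfl⟩
  obtain ⟨t11, ht11⟩ : ∃ c : ℝ, c = 4 * (2 * K + 9) / β ^ 2 := ⟨_, rfl⟩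
  have h1 : 0 ≤ t1 := by rw [ht1]; positivity
  have h2 : 0 ≤ t2 := by rw [ht2]; positivity
  have h3 : 0 ≤ t3 := by rw [ht3]; positivity
  have h4 : 0 ≤ t4 := by rw [ht4]; positivity
  have h6 : 0 ≤ t6 := by rw [ht6]; positivity
  have h8 : 0 ≤ t8 := by rw [ht8]; positivity
  have h10 : 0 ≤ t10 := by rw [ht10]; positivity
  have h11 : 0 ≤ t11 := by rw [ht11]; positivity
  refine ⟨2 + t1 + t2 + t3 + t4 + cη + t6 + t8 + 2 * cL + t10 + t11, cL + 3, by positivity, by positivity, ?_⟩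
  intro N₀ hPstar hN₀ D hD1 hD4 ε hε0 hεK E R L hE hR hL
  obtain ⟨hP1, hP8, hsqrtN, hlogN, hDb⟩ := scale_facts hN₀
  obtain ⟨P, hP⟩ : ∃ P : ℝ, P = N₀ ^ ((8 : ℕ) : ℝ)⁻¹ := ⟨_, rfl⟩
  rw [← hP] at hPstar hP1 hP8 hsqrtN hlogN hDb ⊢
  have hP0 : 0 < P := by linarith only [hP1]
  have hP2 : 2 ≤ P := by linarith only [hPstar, h1, h2, h3, h4, hcη0, h6, h8, hcL0, h10, h11]
  have hPβ : t1 ≤ P := by linarith only [hPstar, h1, h2, h3, h4, hcη0, h6, h8, hcL0, h10, h11]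
  have hPc4 : t2 ≤ P := by linarith only [hPstar, h1, h2, h3, h4, hcη0, h6, h8, hcL0, h10, h11]
  have hPc5 : t3 ≤ P := by linarith only [hPstar, h1, h2, h3, h4, hcη0, h6, h8, hcL0, h10, h11]
  have hPc6 : t4 ≤ P := by linarith only [hPstar, h1, h2, h3, h4, hcη0, h6, h8, hcL0, h10, h11]
  have hPcη : cη ≤ P := by linarith only [hPstar, h1, h2, h3, h4, hcη0, h6, h8, hcL0, h10, h11]
  have hPc8 : t6 ≤ P := by linarith only [hPstar, h1, h2, h3, h4, hcη0, h6, h8, hcL0, h10, h11]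
  have hPc13 : t8 ≤ P := by linarith only [hPstar, h1, h2, h3, h4, hcη0, h6, h8, hcL0, h10, h11]
  have hPc3 : 2 * cL ≤ P := by linarith only [hPstar, h1, h2, h3, h4, hcη0, h6, h8, hcL0, h10, h11]
  have hPc10 : t10 ≤ P := by linarith only [hPstar, h1, h2, h3, h4, hcη0, h6, h8, hcL0, h10, h11]
  have hPc11 : t11 ≤ P := by linarith only [hPstar, h1, h2, h3, h4, hcη0, h6, h8, hcL0, h10, h11]
  have hP21 : P ≤ P ^ 2 := le_self_pow₀ hP1 (by norm_num)
  have hP32 : P ^ 2 ≤ P ^ 3 := pow_le_pow_right₀ hP1 (by norm_num)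
  have hP53 : P ^ 3 ≤ P ^ 5 := pow_le_pow_right₀ hP1 (by norm_num)
  have hP65 : P ^ 5 ≤ P ^ 6 := pow_le_pow_right₀ hP1 (by norm_num)
  have hP86 : P ^ 6 ≤ P ^ 8 := pow_le_pow_right₀ hP1 (by norm_num)
  have hP2pos : 0 ≤ P ^ 2 := by positivity
  have hP3pos : 0 < P ^ 3 := by positivity
  have hP5pos : 0 ≤ P ^ 5 := by positivity
  have hP8pos : 0 ≤ P ^ 8 := by positivity
  have hP51 : (1 : ℝ) ≤ P ^ 5 := one_le_pow₀ hP1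
  have hP664 : (64 : ℝ) ≤ P ^ 6 := by
    have := pow_le_pow_left₀ (by norm_num : (0:ℝ) ≤ 2) hP2 6
    norm_num at this; exact this
  have hD1r : (1 : ℝ) ≤ D := by exact_mod_cast hD1
  have hD0r : (0 : ℝ) ≤ D := by linarith only [hD1r]
  have hD : (D : ℝ) ≤ 2 * P ^ 2 := hDb D hD0r hD4
  have hεb : ε ≤ 2 * K * P ^ 5 := by
    refine hεK.trans ?_
    have hs : Real.sqrt (2 * N₀ * D) ≤ 2 * P ^ 5 := by
      rw [show (2 : ℝ) * P ^ 5 = Real.sqrt ((2 * P ^ 5) ^ 2) by rw [Real.sqrt_sq (by positivity)]]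
      refine Real.sqrt_le_sqrt ?_
      rw [← hP8]
      have : 2 * P ^ 8 * (D : ℝ) ≤ 2 * P ^ 8 * (2 * P ^ 2) := mul_le_mul_of_nonneg_left hD (by positivity)
      nlinarith only [this]
    have := mul_le_mul_of_nonneg_left hs hK
    linarith only [this]
  have h8P : 8 * P ^ 2 ≤ P ^ 8 := by nlinarith only [hP664, hP2pos]
  have h64P : 64 * P ^ 2 ≤ P ^ 8 := by nlinarith only [hP664, hP2pos]
  -- the smallest pinned edge number `N₂ = (N₀ − 2) − 2D ≥ P⁸/4`
  have hN₁ : P ^ 8 / 4 ≤ (N₀ - 2) - 2 * D := by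
    rw [← hP8]
    have hq : (4 : ℝ) ≤ P ^ 2 := by nlinarith only [hP2]
    nlinarith only [hD, h64P, hq, hP2pos]
  have hN₁' : (N₀ - 2) - 2 * D ≤ P ^ 8 := by rw [← hP8]; linarith only [hD0r]
  have hN₁pos : 0 < (N₀ - 2) - 2 * D := lt_of_lt_of_le (by positivity) hN₁
  have hN₀2D : P ^ 8 / 4 ≤ N₀ - 2 * D := by linarith only [hN₁]
  have hΛ : ε + 8 + 14 * D + 1 ≤ cΛ * P ^ 5 := by
    rw [hcΛ]
    have : (D : ℝ) ≤ 2 * P ^ 5 := hD.trans (by linarith only [hP32, hP53])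
    nlinarith only [hεb, this, hP51, hK]
  have hN₀1 : P ^ 8 / 2 ≤ N₀ - 1 := by rw [← hP8]; linarith only [h8P, hP2pos, hP21, hP2]
  have hN₀1pos : 0 < N₀ - 1 := lt_of_lt_of_le (by positivity) hN₀1
  have hE0 : 0 ≤ E := by rw [hE]; positivity
  have hEb : E ≤ cE * P ^ 2 := by
    rw [hE, hcE, div_le_iff₀ (by positivity)]
    have h1 : ε + 1 + C₂ ≤ (2 * K + 1 + C₂) * P ^ 5 := by nlinarith only [hεb, hP51, hC₂, hK]
    have h2 : (ε + 1 + C₂) ^ 2 ≤ ((2 * K + 1 + C₂) * P ^ 5) ^ 2 := pow_le_pow_left₀ (by positivity) h1 2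
    have h3 : C₁ * (ε + 1 + C₂) ^ 2 ≤ C₁ * ((2 * K + 1 + C₂) * P ^ 5) ^ 2 := mul_le_mul_of_nonneg_left h2 hC₁
    have h4 : 2 * C₁ * (2 * K + 1 + C₂) ^ 2 / β ^ 4 * P ^ 2 * (β ^ 4 * (N₀ - 1)) =
        2 * C₁ * (2 * K + 1 + C₂) ^ 2 * P ^ 2 * (N₀ - 1) := by field_simp
    rw [h4]
    have h5 : C₁ * ((2 * K + 1 + C₂) * P ^ 5) ^ 2 = C₁ * (2 * K + 1 + C₂) ^ 2 * P ^ 2 * P ^ 8 := by ring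
    have h6 : C₁ * (2 * K + 1 + C₂) ^ 2 * P ^ 2 * P ^ 8 ≤ C₁ * (2 * K + 1 + C₂) ^ 2 * P ^ 2 * (2 * (N₀ - 1)) :=
      mul_le_mul_of_nonneg_left (by linarith only [hN₀1]) (by positivity)
    linarith only [h3, h5, h6]
  have hlogC : 0 ≤ Real.log (2 * C₃) + 6 * Real.log N₀ := by
    have hlogN0 : 0 ≤ Real.log N₀ := Real.log_nonneg hN₀
    rcases le_or_gt 0 (Real.log (2 * C₃)) with h | h
    · linarith only [h, hlogN0]
    · have hPc : 1 / (2 * C₃) ≤ P := by rw [← ht10]; exact hPc10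
      have hPN : P ≤ N₀ := by
        rw [← hP8]; exact le_self_pow₀ hP1 (by norm_num)
      have h1 : Real.log (1 / (2 * C₃)) ≤ Real.log N₀ := Real.log_le_log (by positivity) (hPc.trans hPN)
      rw [one_div, Real.log_inv] at h1
      linarith only [h1, hlogN0]
  have hR0 : 0 ≤ R := by rw [hR]; linarith only [hE0, hlogC, hD0r]
  have hRb : R ≤ cR * P ^ 2 := by
    rw [hR, hcR]
    have h1 : Real.log (2 * C₃) ≤ |Real.log (2 * C₃)| * P ^ 2 := by
      have h2 : |Real.log (2 * C₃)| ≤ |Real.log (2 * C₃)| * P ^ 2 := by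
        have : (1 : ℝ) ≤ P ^ 2 := one_le_pow₀ hP1
        nlinarith only [abs_nonneg (Real.log (2 * C₃)), this]
      linarith only [le_abs_self (Real.log (2 * C₃)), h2]
    linarith only [hEb, h1, hlogN, hD]
  have hL2D : 2 * (D : ℝ) ≤ L := by rw [hL]; linarith only [Real.sqrt_nonneg (4 * N₀ * R)]
  have hL0 : 0 ≤ L := by linarith only [hL2D, hD0r]
  have hLsq : (L - 2 * D) ^ 2 = 4 * N₀ * R := by
    rw [hL, add_sub_cancel_left, Real.sq_sqrt (by positivity)]
  have hLb : L ≤ cL * P ^ 5 := by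
    rw [hL, hcL]
    have h1 : Real.sqrt (4 * N₀ * R) ≤ 2 * Real.sqrt cR * P ^ 5 := by
      have h2 : 4 * N₀ * R ≤ (4 * cR) * (P ^ 5) ^ 2 := by
        rw [← hP8]
        have : 4 * P ^ 8 * R ≤ 4 * P ^ 8 * (cR * P ^ 2) := mul_le_mul_of_nonneg_left hRb (by positivity)
        linarith only [this]
      calc Real.sqrt (4 * N₀ * R) ≤ Real.sqrt ((4 * cR) * (P ^ 5) ^ 2) := Real.sqrt_le_sqrt h2
        _ = Real.sqrt (4 * cR) * P ^ 5 := by rw [Real.sqrt_mul (by positivity), Real.sqrt_sq (by positivity)]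
        _ = 2 * Real.sqrt cR * P ^ 5 := by
            rw [Real.sqrt_mul (by norm_num), show Real.sqrt 4 = 2 by
              rw [show (4:ℝ) = 2 ^ 2 by norm_num, Real.sqrt_sq (by norm_num)]]
    have h3 : (D : ℝ) ≤ 2 * P ^ 5 := hD.trans (by linarith only [hP32, hP53])
    linarith only [h1, h3]
  have hLD1 : L + D + 1 ≤ (cL + 3) * P ^ 5 := by
    have h3 : (D : ℝ) ≤ 2 * P ^ 5 := hD.trans (by linarith only [hP32, hP53])
    nlinarith only [hLb, h3, hP51]
  have hden : (β ^ 2 / 8) ^ 4 * β * (P ^ 8 / 4) ≤ (β ^ 2 / 8) ^ 4 * (β * ((N₀ - 2) - 2 * D)) := by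
    have := mul_le_mul_of_nonneg_left hN₁ (by positivity : (0:ℝ) ≤ (β ^ 2 / 8) ^ 4 * β)
    linarith only [this]
  have hdenpos : 0 < (β ^ 2 / 8) ^ 4 * (β * ((N₀ - 2) - 2 * D)) := by positivity
  have hηs : 8 * (L + D + 1) / ((β ^ 2 / 8) ^ 4 * (β * ((N₀ - 2) - 2 * D))) ≤ cη / P ^ 3 := by
    rw [div_le_div_iff₀ hdenpos hP3pos, hcη]
    have h1 : 8 * (L + D + 1) * P ^ 3 ≤ 8 * ((cL + 3) * P ^ 5) * P ^ 3 :=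
      mul_le_mul_of_nonneg_right (by linarith only [hLD1]) hP3pos.le
    have h2 : 32 * (cL + 3) / ((β ^ 2 / 8) ^ 4 * β) * ((β ^ 2 / 8) ^ 4 * β * (P ^ 8 / 4)) =
        8 * ((cL + 3) * P ^ 5) * P ^ 3 := by
      field_simp; ring
    calc 8 * (L + D + 1) * P ^ 3 ≤ 8 * ((cL + 3) * P ^ 5) * P ^ 3 := h1
      _ = 32 * (cL + 3) / ((β ^ 2 / 8) ^ 4 * β) * ((β ^ 2 / 8) ^ 4 * β * (P ^ 8 / 4)) := h2.symm
      _ ≤ 32 * (cL + 3) / ((β ^ 2 / 8) ^ 4 * β) * ((β ^ 2 / 8) ^ 4 * (β * ((N₀ - 2) - 2 * D))) :=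
          mul_le_mul_of_nonneg_left hden (by positivity)
  have hη1 : cη / P ^ 3 ≤ 1 := by
    rw [div_le_one hP3pos]
    exact hPcη.trans (hP21.trans hP32)
  have hηx1 : 8 * (L + D + 1) / ((β ^ 2 / 8) ^ 4 * (β * ((N₀ - 2) - 2 * D))) ≤ 1 := hηs.trans hη1
  -- the far term with `6 log N₀`
  have c10 : (D : ℝ) * (4 / 3 : ℝ) ^ D * Real.exp (-((L - 2 * D) ^ 2 / (4 * N₀))) ≤
      (Real.exp (-E) / (C₃ * N₀ ^ 2)) / (2 * N₀ ^ 4) := by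
    have hN₀pos : 0 < N₀ := by linarith only [hN₀]
    rw [hLsq, show 4 * N₀ * R / (4 * N₀) = R by field_simp]
    have hq1 := mul_fourThirds_pow_le_exp D
    have hq2 : Real.exp (D : ℝ) * Real.exp (-R) = Real.exp (-E) / (C₃ * N₀ ^ 2) / (2 * N₀ ^ 4) := by
      rw [← Real.exp_add, hR]
      have : (D : ℝ) + -(E + Real.log (2 * C₃) + 6 * Real.log N₀ + D) =
          -E + -(Real.log (2 * C₃) + 6 * Real.log N₀) := by ring
      rw [this, Real.exp_add, Real.exp_neg (Real.log (2 * C₃) + 6 * Real.log N₀), Real.exp_add,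
        Real.exp_log (by positivity), show (6 : ℝ) * Real.log N₀ = Real.log (N₀ ^ 6) by
          rw [Real.log_pow]; norm_num, Real.exp_log (by positivity)]
      field_simp
    calc (D : ℝ) * (4 / 3 : ℝ) ^ D * Real.exp (-R) ≤ Real.exp D * Real.exp (-R) :=
          mul_le_mul_of_nonneg_right hq1 (Real.exp_pos _).le
      _ = _ := hq2
  rw [ht1, div_le_iff₀ hβ] at hPβ
  rw [ht3, div_le_iff₀ hβ] at hPc5
  rw [ht8, div_le_iff₀ hβ] at hPc13
  rw [ht2, div_le_iff₀ (by positivity)] at hPc4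
  rw [ht4, div_le_iff₀ (by positivity)] at hPc6
  rw [ht6, div_le_iff₀ (by positivity)] at hPc8
  rw [ht11, div_le_iff₀ (by positivity)] at hPc11
  have hβN₁ : β * (P ^ 8 / 4) ≤ β * ((N₀ - 2) - 2 * D) := mul_le_mul_of_nonneg_left hN₁ hβ.le
  have hβN₀2D : β * (P ^ 8 / 4) ≤ β * (N₀ - 2 * D) := mul_le_mul_of_nonneg_left hN₀2D hβ.le
  refine ⟨?_, hL2D, ?_, ?_, ?_, ?_, ?_, ?_, c10, hLD1, ?_, hN₁, ?_, ?_, ?_, hR0, ?_, ?_⟩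
  · -- `16D + 16 ≤ N₀ − 2`
    rw [← hP8]
    have hq2 : (1 : ℝ) ≤ P ^ 2 := one_le_pow₀ hP1
    nlinarith only [hD, h64P, hq2]
  · -- `2L ≤ N₀ − 2`
    rw [← hP8]
    have hq : 2 * cL * P ^ 5 ≤ P * P ^ 5 := mul_le_mul_of_nonneg_right hPc3 hP5pos
    have e : P * P ^ 5 = P ^ 6 := by ring
    have hq2 : 2 * P ^ 6 ≤ P ^ 8 := by
      have hP2sq : (2 : ℝ) ≤ P ^ 2 := by nlinarith only [hP2]
      have h6 : (0 : ℝ) ≤ P ^ 6 := by positivity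
      calc 2 * P ^ 6 ≤ P ^ 2 * P ^ 6 := mul_le_mul_of_nonneg_right hP2sq h6
        _ = P ^ 8 := by ring
    nlinarith only [hLb, hq, e, hq2, hcL0, hP5pos, hP664]
  · -- `h1` at `(N₀−2, ε+8)`
    rw [← hP8]
    have hq1 : L + D + (ε + 8 + 14 * D + 1) ≤ (cL + 2 + cΛ) * P ^ 5 := by
      have : (D : ℝ) ≤ 2 * P ^ 5 := hD.trans (by linarith only [hP32, hP53])
      nlinarith only [hLb, hΛ, this]
    have hq2 : 2 * (cL + 2 + cΛ) * P ^ 5 ≤ (P * β ^ 2) * P ^ 5 := mul_le_mul_of_nonneg_right hPc4 hP5pos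
    have e : (P * β ^ 2) * P ^ 5 = β ^ 2 * P ^ 6 := by ring
    have hq3 : β ^ 2 * P ^ 6 ≤ β ^ 2 * P ^ 8 := mul_le_mul_of_nonneg_left hP86 (by positivity)
    have hq4 : β ^ 2 * 2 ≤ β ^ 2 * (P ^ 8 / 2) := mul_le_mul_of_nonneg_left (by nlinarith only [h8P, hP2pos, hP2]) (by positivity)
    nlinarith only [hq1, hq2, e, hq3, hq4]
  · -- `h2`
    have hq1 : L + D + (ε + 8 + 14 * D + 1) + 3 ≤ (cL + cΛ + 5) * P ^ 5 := by
      have : (D : ℝ) ≤ 2 * P ^ 5 := hD.trans (by linarith only [hP32, hP53])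
      nlinarith only [hLb, hΛ, this, hP51]
    have hq2 : 32 * (cL + cΛ + 5) * P ^ 5 ≤ (P * β) * P ^ 5 := mul_le_mul_of_nonneg_right hPc5 hP5pos
    have e : (P * β) * P ^ 5 = β * P ^ 6 := by ring
    have hq3 : β * P ^ 6 ≤ β * P ^ 8 := mul_le_mul_of_nonneg_left hP86 hβ.le
    linarith only [hq1, hq2, e, hq3, hβN₁]
  · -- `h3`
    have hq2 : 8 * (cL + 3) * P ^ 5 ≤ (P * ((β ^ 2 / 8) ^ 2 * β)) * P ^ 5 :=
      mul_le_mul_of_nonneg_right hPc6 hP5pos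
    have e : (P * ((β ^ 2 / 8) ^ 2 * β)) * P ^ 5 = ((β ^ 2 / 8) ^ 2 * β) * P ^ 6 := by ring
    have hq3 : ((β ^ 2 / 8) ^ 2 * β) * P ^ 6 ≤ ((β ^ 2 / 8) ^ 2 * β) * P ^ 8 :=
      mul_le_mul_of_nonneg_left hP86 (by positivity)
    have hq4 : (β ^ 2 / 8) ^ 2 * β * (P ^ 8 / 4) ≤ (β ^ 2 / 8) ^ 2 * (β * ((N₀ - 2) - 2 * D)) := by
      have := mul_le_mul_of_nonneg_left hN₁ (by positivity : (0:ℝ) ≤ (β ^ 2 / 8) ^ 2 * β)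
      linarith only [this]
    linarith only [hLD1, hq2, e, hq3, hq4]
  · -- `h4`
    have hP7 : (1 : ℝ) ≤ P ^ 7 := one_le_pow₀ hP1
    have hq : 32 * P ^ 7 ≤ P * β * P ^ 7 := mul_le_mul_of_nonneg_right hPβ (by positivity)
    have e : P * β * P ^ 7 = β * P ^ 8 := by ring
    linarith only [hP7, hq, e, hβN₁]
  · -- `h5`
    have hq1 : (D : ℝ) * (1 + 8 * (L + D + 1) / ((β ^ 2 / 8) ^ 4 * (β * ((N₀ - 2) - 2 * D)))) ≤ 2 * P ^ 2 * 2 :=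
      mul_le_mul hD (by linarith only [hηx1]) (by positivity) (by positivity)
    have hq2 : 24 * P ^ 2 ≤ (P * ((β ^ 2 / 8) ^ 4 * β)) * P ^ 2 := mul_le_mul_of_nonneg_right hPc8 hP2pos
    have e : (P * ((β ^ 2 / 8) ^ 4 * β)) * P ^ 2 = ((β ^ 2 / 8) ^ 4 * β) * P ^ 3 := by ring
    have hq3 : ((β ^ 2 / 8) ^ 4 * β) * P ^ 3 ≤ ((β ^ 2 / 8) ^ 4 * β) * (P ^ 8 / 4) := by
      refine mul_le_mul_of_nonneg_left ?_ (by positivity)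
      nlinarith only [hP53, hP65, hP86, h64P, hP2pos, hP32]
    linarith only [hq1, hq2, e, hq3, hden, hdenpos]
  · -- `32 c_L/((β²/8)⁴β) ≤ P³` (`= cη ≤ P ≤ P³`)
    rw [← hcη]; exact hPcη.trans (hP21.trans hP32)
  · -- `βN₀ + D + 3 ≤ N₀/4 − 1/2`
    rw [← hP8]
    have hq : β * P ^ 8 ≤ (1 / 5) * P ^ 8 := mul_le_mul_of_nonneg_right hβ5 hP8pos
    have hq2 : (4 : ℝ) ≤ P ^ 2 := by nlinarith only [hP2]
    nlinarith only [hq, hD, h64P, hq2]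
  · -- `8(N₀/2 − 1) ≤ (4+β)(N₀ − 2D)`
    rw [← hP8]
    have hq : 32 * P ^ 2 ≤ P * β * P ^ 2 := mul_le_mul_of_nonneg_right hPβ hP2pos
    have e : P * β * P ^ 2 = β * P ^ 3 := by ring
    have hq2 : β * P ^ 3 ≤ β * P ^ 8 := mul_le_mul_of_nonneg_left (hP53.trans (hP65.trans hP86)) hβ.le
    have hq3 : β * (D : ℝ) ≤ β * (2 * P ^ 2) := mul_le_mul_of_nonneg_left hD hβ.le
    nlinarith only [hq, e, hq2, hq3, hD, hβ, hβ5, hP2pos]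
  · -- `2D + ε + 8 ≤ βN₀/4`
    rw [← hP8]
    have hq : 4 * (12 + 2 * K) * P ^ 5 ≤ P * β * P ^ 5 := mul_le_mul_of_nonneg_right hPc13 hP5pos
    have e : P * β * P ^ 5 = β * P ^ 6 := by ring
    have hq2 : β * P ^ 6 ≤ β * P ^ 8 := mul_le_mul_of_nonneg_left hP86 hβ.le
    have hq3 : (D : ℝ) ≤ 2 * P ^ 5 := hD.trans (by linarith only [hP32, hP53])
    nlinarith only [hq, e, hq2, hq3, hεb, hK, hP5pos, hP51]
  · -- `ε + 9 ≤ β²(N₀−1)/2`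
    have hq1 : ε + 9 ≤ (2 * K + 9) * P ^ 5 := by nlinarith only [hεb, hP51, hK]
    have hq : 4 * (2 * K + 9) * P ^ 5 ≤ P * β ^ 2 * P ^ 5 := mul_le_mul_of_nonneg_right hPc11 hP5pos
    have e : P * β ^ 2 * P ^ 5 = β ^ 2 * P ^ 6 := by ring
    have hq2 : β ^ 2 * P ^ 6 ≤ β ^ 2 * P ^ 8 := mul_le_mul_of_nonneg_left hP86 (by positivity)
    have hq3 : β ^ 2 * (P ^ 8 / 2) ≤ β ^ 2 * (N₀ - 1) := mul_le_mul_of_nonneg_left hN₀1 (by positivity)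
    linarith only [hq1, hq, e, hq2, hq3]
  · -- `24 ≤ (β²/8)⁴βN₀`
    rw [← hP8]
    have hP7 : (1 : ℝ) ≤ P ^ 7 := one_le_pow₀ hP1
    have hq : 24 * P ^ 7 ≤ P * ((β ^ 2 / 8) ^ 4 * β) * P ^ 7 := mul_le_mul_of_nonneg_right hPc8 (by positivity)
    have e : P * ((β ^ 2 / 8) ^ 4 * β) * P ^ 7 = (β ^ 2 / 8) ^ 4 * (β * P ^ 8) := by ring
    linarith only [hP7, hq, e]

end Summit.PneNP.PneNP.Theorems.ChebyshevTracialDesignGammaDirectionBulkNumerics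

end
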